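import Mathlib.MeasureTheory.Measure.WithDensity
import Mathlib.MeasureTheory.Integral.Bochner.ContinuousLinearMap
import Mathlib.Data.Set.Countable
import Literature.Probability.LatticeModels.RandomWalkLoopMeasure
import HarnessLib

/-!
# The regularised loop-avoidance law (route-posited scheme of route SAWLoopAvoidanceChaos)

Topic `Probability/RandomPlanarGeometry`; definition item `defn-LoopAvoidanceRegularisedLaw`, wanted
by the cruxes `ChaosExists` (stmt-CriticalPhenomena-4521), `LatticeIsChaos`, `ChaosConformal`,
`ChaosRestriction` (stmt-CriticalPhenomena-4524) and the support item `LatticeIsChaosSome` of route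
CriticalPhenomena/SAWLoopAvoidanceChaos, whose Theses file repeats the SAME five-line `let` block in
each of these five declarations. This file turns that block into definitions, so that each signature
shrinks to one line, and proves the bookkeeping API the provers need.

## The scheme (as posited by the route; verbatim the inlined `let` block)

Fix a Dobrushin domain `D`, a cutoff `ε` (intended `ε > 0`) and a counterterm `θ : ℝ → ℝ`.

* `LoopAvoidance.box ε x` — the closed axis-parallel square of side `ε` centred at the mesh point
  `ε • x` of the site `x : Site 2`.
* `LoopAvoidance.hit D ε γ` — the set of sites `x` of the discrete domain
  `Ω_ε = meshDomain D.carrier ε` (DomainDiscretisation) whose box meets the trace `γ.range` of the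
  curve class `γ : CurveClass ℂ`; `N_ε(γ) = (hit D ε γ).ncard`.
* `LoopAvoidance.dens D θ ε γ = exp (θ ε · N_ε(γ) − m^{RW}_{Ω_ε}(hit D ε γ))`, where
  `m^{RW}_{Ω_ε}(W) = rwLoopMass (discreteDomainGraph D.carrier ε) W` is the random-walk loop measure
  (rooted weight `(1/4)^{|l|}/|l|`, Lawler–Trujillo Ferreras; Lawler 2018 Def. 8/10) of the loops of
  `Ω_ε` meeting `W` (file `LatticeModels/RandomWalkLoopMeasure`), so that `exp (−m^{RW})` is the
  probability that the unit-intensity random-walk loop soup on `Ω_ε` has no loop meeting the boxes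
  of `γ` (`loopSoupVoid`, Lawler 2018 Def. 12) and `exp (θ ε · N_ε)` is the box-count counterterm.
* `LoopAvoidance.regularisedLaw D θ μ ε = (∫⁻ dens dμ)⁻¹ • μ.withDensity dens` — the curve law `μ`
  (intended: the chordal SLE₂ law in `D`) reweighted by `dens` and normalised: "`μ` conditioned to
  dodge the mesh-`ε` loop soup, UV-renormalised by a box-count counterterm". For the lattice
  dictionary behind it (the `λ`-SAW weight `β^{|ω|} exp(−(c/2) m(ω))` interpolating LERW, `c = −2`,
  and SAW, `c = 0`) see Kennedy–Lawler 2013 §1.1 and Kozdron–Lawler 2007; for "SLE plus the loops of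
  an independent loop soup" see Lawler–Werner 2004. The OBJECT itself is posited by the route (it is
  an explicit finite construction at each `ε`; nothing about its `ε → 0` behaviour is asserted here).

`regularisedLaw_eq_inlined` records, by `rfl`, that the route's `let` block (with `sle2 D` replaced by
a general `μ`) is `regularisedLaw D θ μ`; hence each of the five route declarations is definitionally
its one-line restatement through `regularisedLaw`.

## API proved here

* `isClosed_box`, `meshPoint_mem_box`; `hit_subset_meshDomain`, `hit_finite`;
* measurability: meeting a closed set is a closed event on `CurveClass ℂ`
  (`isClosed_setOf_inter_range_nonempty`, from `CurveClass.isClosed_hitsBefore_empty_right`), hence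
  `isClosed_setOf_mem_hit`, `measurableSet_hit_eq` (fibres of `hit`), and for `ε > 0` EVERY function
  of `hit D ε γ` is Borel measurable (`measurable_comp_hit`; the range of `hit D ε` is a countable
  family of finite sets), in particular `measurable_dens`;
* `dens_pos`, `dens_le` (uniform bound `exp (|θ ε| · #Ω_ε)`), `lintegral_dens_ne_zero`,
  `lintegral_dens_lt_top`; hence `isProbabilityMeasure_regularisedLaw` for a probability measure
  `μ`, a (bounded) Dobrushin domain and `ε > 0`;
* `regularisedLaw_apply`, `regularisedLaw_absolutelyContinuous`, and the change-of-measure formula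
  `integral_regularisedLaw : ∫ f d(reg) = (∫⁻ dens dμ)⁻¹.toReal • ∫ dens • f dμ`;
* the counterterm cancellation behind crux `ChaosRestriction`: if the hit sets of `γ` in two
  domains agree then `dens^{D'}(γ) / dens^{D}(γ) = exp (m_{Ω_ε}(W) − m_{Ω'_ε}(W))`
  (`dens_div_dens_of_hit_eq`); the loop-measure side of the mesoscopic restriction identity (the
  difference is the mass of the loops of `Ω_ε` meeting `W` that are not loops of `Ω'_ε`) is a
  statement about `rwLoopMass` alone and is left to a companion file.

NOT here: summability of the loop series on finite killed domains (so `rwLoopMass` may take its junk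
value `0`; nothing below depends on it), any `ε → 0` statement, and the route items themselves.
Junk conventions: for `ε ≤ 0` everything is still defined (`meshDomain` is then degenerate); the
measurability and finiteness lemmas assume `0 < ε`.

## References

* T. Kennedy, G. F. Lawler, *Lattice effects in the scaling limit of the two-dimensional
  self-avoiding walk*, Contemp. Math. 601 (2013), arXiv:1109.3091, §1.1. [KennedyLawler2013]
* G. F. Lawler, J. Trujillo Ferreras, *Random walk loop soup*, TAMS 359 (2007). [LawlerTrujilloferreras2006]
* G. F. Lawler, W. Werner, *The Brownian loop soup*, PTRF 128 (2004). [LawlerWerner2004]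
* G. F. Lawler, *Topics in loop measures and the loop-erased walk*, Probab. Surveys 15 (2018),
  Def. 8, 10, 12. [Lawler2018]
-/

noncomputable section

open MeasureTheory Set Filter Literature.Probability.LatticeModels
open scoped ENNReal Classical Topology

namespace Literature.Probability.RandomPlanarGeometry

namespace LoopAvoidance

/-! ### The scheme -/

/-- The closed axis-parallel box of side `ε` centred at the mesh point `ε • x` of the site `x`:
`{z | |Re z − ε x₀| ≤ ε/2 ∧ |Im z − ε x₁| ≤ ε/2}` (the cutoff cells of the route's regularisation;
verbatim the `box` of the route's `let` block). [folklore] -/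
def box (ε : ℝ) (x : Site 2) : Set ℂ :=
  {z : ℂ | |z.re - ε * ((x 0 : ℤ) : ℝ)| ≤ ε / 2 ∧ |z.im - ε * ((x 1 : ℤ) : ℝ)| ≤ ε / 2}

/-- The **hit set** of a curve class at cutoff `ε` in the Dobrushin domain `D`: the sites of the
discrete domain `Ω_ε = meshDomain D.carrier ε` whose closed `ε`-box meets the trace of `γ`
(verbatim the `hit` of the route's `let` block; `N_ε(γ)` is its `ncard`). [folklore] -/
def hit (D : DobrushinDomain) (ε : ℝ) (γ : CurveClass ℂ) : Set (Site 2) :=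
  {x | x ∈ meshDomain D.carrier ε ∧ (box ε x ∩ γ.range).Nonempty}

/-- The **regularising density** `dens_ε(γ) = exp (θ(ε) · N_ε(γ) − m^{RW}_{Ω_ε}(hit_ε γ))`: the
box-count counterterm times the probability `exp (−m^{RW})` that the unit-intensity random-walk loop
soup on `Ω_ε` (rooted loop weight `(1/4)^{|l|}/|l|`, Lawler 2018 Def. 8/12; `rwLoopMass`) contains
no loop meeting the boxes of `γ` (verbatim the `dens` of the route's `let` block, with `mass ε W`
written as `rwLoopMass (discreteDomainGraph D.carrier ε) W`, to which it is definitionally equal).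
Lattice dictionary it transposes (Kennedy–Lawler 2013 §1.1, p. 4: "the (rooted) random walk loop
measure … assigns weight `(1/4)^n n^{-1}` to each loop of `n > 0` steps", `m_D(ω)` = the measure of
the loops in `D` sharing a site with `ω`, `λ`-SAW weight `q(ω) = β^{|ω|} exp{−(c/2) m_D(ω)}`,
`c = 0` SAW, `c = −2` LERW): `exp(−m_D(ω)) = q_{c=0}(ω) / q_{c=−2}(ω)` at equal `β`, the factor
turning the loop-erased-walk weight into the SAW weight. [cite: KennedyLawler2013, §1.1] -/
def dens (D : DobrushinDomain) (θ : ℝ → ℝ) (ε : ℝ) (γ : CurveClass ℂ) : ℝ :=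
  Real.exp (θ ε * ((hit D ε γ).ncard : ℝ) -
    rwLoopMass (discreteDomainGraph D.carrier ε) (hit D ε γ))

/-- The **regularised loop-avoidance law** `reg_ε^D(θ, μ) = (∫⁻ dens_ε dμ)⁻¹ • μ.withDensity dens_ε`:
the curve law `μ` on `CurveClass ℂ` (intended: chordal SLE₂ in `D`) conditioned to dodge the
mesh-`ε` random-walk loop soup on `Ω_ε`, renormalised by the box-count counterterm `exp (θ(ε) N_ε)`
(verbatim the `reg` of the route's `let` block with `sle2 D` generalised to `μ`; route-posited
object of route CriticalPhenomena/SAWLoopAvoidanceChaos — an explicit finite construction at each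
`ε`, no limit asserted). Junk value `0` if `∫⁻ dens dμ = ∞`, and `0` if `μ = 0`. [folklore] -/
def regularisedLaw (D : DobrushinDomain) (θ : ℝ → ℝ) (μ : Measure (CurveClass ℂ)) (ε : ℝ) :
    Measure (CurveClass ℂ) :=
  (∫⁻ γ, ENNReal.ofReal (dens D θ ε γ) ∂μ)⁻¹ • μ.withDensity fun γ => ENNReal.ofReal (dens D θ ε γ)

/-- **The route's `let` block is `regularisedLaw`.** For every law `μ` (in the route: `μ = sle2 D`),
the function `reg : ℝ → Measure (CurveClass ℂ)` defined by the five-line `let` block repeated in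
`ChaosExists` / `LatticeIsChaos` / `ChaosConformal` / `ChaosRestriction` / `LatticeIsChaosSome` of
route SAWLoopAvoidanceChaos is, by `rfl`, `regularisedLaw D θ μ`; so each of those declarations is
definitionally equal to its one-line restatement. [folklore] -/
theorem regularisedLaw_eq_inlined (D : DobrushinDomain) (θ : ℝ → ℝ) (μ : Measure (CurveClass ℂ)) :
    (let box : ℝ → Site 2 → Set ℂ := fun ε x =>
        {z : ℂ | |z.re - ε * ((x 0 : ℤ) : ℝ)| ≤ ε / 2 ∧ |z.im - ε * ((x 1 : ℤ) : ℝ)| ≤ ε / 2}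
      let hit : ℝ → CurveClass ℂ → Set (Site 2) := fun ε γ =>
        {x | x ∈ meshDomain D.carrier ε ∧ (box ε x ∩ γ.range).Nonempty}
      let mass : ℝ → Set (Site 2) → ℝ := fun ε W =>
        ∑' p : (Σ x : Site 2, (discreteDomainGraph D.carrier ε).Walk x x),
          (if 0 < p.2.length ∧ (∃ v ∈ p.2.support, v ∈ W) then
            ((1 : ℝ) / 4) ^ p.2.length / (p.2.length : ℝ) else 0)
      let dens : ℝ → CurveClass ℂ → ℝ := fun ε γ =>
        Real.exp (θ ε * ((hit ε γ).ncard : ℝ) - mass ε (hit ε γ))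
      let reg : ℝ → Measure (CurveClass ℂ) := fun ε =>
        (∫⁻ γ, ENNReal.ofReal (dens ε γ) ∂μ)⁻¹ • μ.withDensity (fun γ => ENNReal.ofReal (dens ε γ))
      reg) = regularisedLaw D θ μ :=
  rfl

/-! ### Boxes and hit sets -/

variable (D : DobrushinDomain) (θ : ℝ → ℝ) (μ : Measure (CurveClass ℂ)) (ε : ℝ)

/-- Membership in a box, unfolded. [folklore] -/
@[simp] theorem mem_box {x : Site 2} {z : ℂ} :
    z ∈ box ε x ↔ |z.re - ε * ((x 0 : ℤ) : ℝ)| ≤ ε / 2 ∧ |z.im - ε * ((x 1 : ℤ) : ℝ)| ≤ ε / 2 :=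
  Iff.rfl

/-- Boxes are closed. [folklore] -/
theorem isClosed_box (x : Site 2) : IsClosed (box ε x) := by
  simp only [box, Set.setOf_and]
  refine IsClosed.inter ?_ ?_
  · exact isClosed_le (by fun_prop) continuous_const
  · exact isClosed_le (by fun_prop) continuous_const

/-- For `ε ≥ 0` the mesh point `ε • x` is (the centre of) its box. [folklore] -/
theorem meshPoint_mem_box (hε : 0 ≤ ε) (x : Site 2) : meshPoint ε x ∈ box ε x := by
  simp only [mem_box, meshPoint_re, meshPoint_im, sub_self, abs_zero]
  constructor <;> linarith

/-- A box has diameter at most `ε` in each coordinate: its points are within `ε` of the centre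
(sup-norm `ε/2`, Euclidean `≤ ε/√2 ≤ ε`). [folklore] -/
theorem dist_meshPoint_le_of_mem_box {x : Site 2} {z : ℂ} (hz : z ∈ box ε x) :
    dist z (meshPoint ε x) ≤ ε := by
  rw [mem_box] at hz
  rw [Complex.dist_eq]
  refine (Complex.norm_le_abs_re_add_abs_im _).trans ?_
  simp only [Complex.sub_re, Complex.sub_im, meshPoint_re, meshPoint_im]
  linarith [hz.1, hz.2]

/-- Membership in the hit set, unfolded. [folklore] -/
@[simp] theorem mem_hit {γ : CurveClass ℂ} {x : Site 2} :
    x ∈ hit D ε γ ↔ x ∈ meshDomain D.carrier ε ∧ (box ε x ∩ γ.range).Nonempty :=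
  Iff.rfl

/-- The hit set consists of sites of the discrete domain `Ω_ε`. [folklore] -/
theorem hit_subset_meshDomain (γ : CurveClass ℂ) : hit D ε γ ⊆ meshDomain D.carrier ε :=
  fun _ h => h.1

/-- For `ε > 0` the hit set is finite (a Dobrushin domain is bounded). [folklore] -/
theorem hit_finite (hε : 0 < ε) (γ : CurveClass ℂ) : (hit D ε γ).Finite :=
  (meshDomain_finite D.isBounded hε).subset (hit_subset_meshDomain D ε γ)

/-- For `ε > 0`, `N_ε(γ) ≤ #Ω_ε`. [folklore] -/
theorem ncard_hit_le (hε : 0 < ε) (γ : CurveClass ℂ) :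
    (hit D ε γ).ncard ≤ (meshDomain D.carrier ε).ncard :=
  Set.ncard_le_ncard (hit_subset_meshDomain D ε γ) (meshDomain_finite D.isBounded hε)

/-! ### Measurability: hitting events are closed -/

/-- **Meeting a closed set is a closed event** on curves modulo reparametrisation: for closed
`A ⊆ ℂ`, `{γ | A ∩ range γ ≠ ∅}` is closed (it is the complement of "the trace stays in the open set
`Aᶜ`", `CurveClass.isClosed_hitsBefore_empty_right`; Aizenman–Burchard 1999 §2.1). [folklore] -/
theorem isClosed_setOf_inter_range_nonempty {A : Set ℂ} (hA : IsClosed A) :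
    IsClosed {γ : CurveClass ℂ | (A ∩ γ.range).Nonempty} := by
  have h : {γ : CurveClass ℂ | (A ∩ γ.range).Nonempty} = (CurveClass.rangeSubset Aᶜ)ᶜ := by
    ext γ
    simp only [mem_setOf_eq, mem_compl_iff, CurveClass.mem_rangeSubset, Set.not_subset,
      Set.inter_nonempty]
    exact ⟨fun ⟨y, hyA, hyγ⟩ => ⟨y, hyγ, fun h => h hyA⟩,
      fun ⟨y, hyγ, hyA⟩ => ⟨y, not_notMem.1 hyA, hyγ⟩⟩
  rw [h, ← CurveClass.hitsBefore_empty_right]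
  exact CurveClass.isClosed_hitsBefore_empty_right hA

/-- For every site `x`, "`x` is hit" is a closed event. [folklore] -/
theorem isClosed_setOf_mem_hit (x : Site 2) : IsClosed {γ : CurveClass ℂ | x ∈ hit D ε γ} := by
  by_cases hx : x ∈ meshDomain D.carrier ε
  · have h : {γ : CurveClass ℂ | x ∈ hit D ε γ} = {γ | (box ε x ∩ γ.range).Nonempty} := by
      ext γ; simp [hx]
    rw [h]
    exact isClosed_setOf_inter_range_nonempty (isClosed_box ε x)
  · have h : {γ : CurveClass ℂ | x ∈ hit D ε γ} = ∅ := by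
      ext γ; simp [hx]
    rw [h]
    exact isClosed_empty

/-- For every site `x`, "`x` is hit" is a Borel event. [folklore] -/
theorem measurableSet_setOf_mem_hit (x : Site 2) :
    MeasurableSet {γ : CurveClass ℂ | x ∈ hit D ε γ} :=
  (isClosed_setOf_mem_hit D ε x).measurableSet

/-- The fibres `{γ | hit D ε γ = S}` of the hit map are Borel (countable intersection over the
sites of `ℤ²`). [folklore] -/
theorem measurableSet_hit_eq (S : Set (Site 2)) :
    MeasurableSet {γ : CurveClass ℂ | hit D ε γ = S} := by
  have h : {γ : CurveClass ℂ | hit D ε γ = S} = ⋂ x : Site 2, {γ | x ∈ hit D ε γ ↔ x ∈ S} := by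
    ext γ
    simp only [mem_setOf_eq, mem_iInter, Set.ext_iff]
  rw [h]
  refine MeasurableSet.iInter fun x => ?_
  by_cases hx : x ∈ S
  · simp only [hx, iff_true]
    exact measurableSet_setOf_mem_hit D ε x
  · simp only [hx, iff_false]
    exact (measurableSet_setOf_mem_hit D ε x).compl

/-- **Every function of the hit set is Borel measurable** (`ε > 0`): `hit D ε` takes its values in
the countable family of finite subsets of `ℤ²` and has Borel fibres. This is the measurability of
`γ ↦ hit_ε γ` asked for by the route (with the discrete σ-algebra on the target). [folklore] -/
theorem measurable_comp_hit {β : Type*} [MeasurableSpace β] (hε : 0 < ε) (g : Set (Site 2) → β) :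
    Measurable fun γ => g (hit D ε γ) := by
  intro T _
  have hcount : {t : Set (Site 2) | t.Finite ∧ g t ∈ T}.Countable := by
    refine (Set.countable_setOf_finite_subset Set.countable_univ).mono ?_
    intro t ht
    exact ⟨ht.1, Set.subset_univ _⟩
  have h : (fun γ => g (hit D ε γ)) ⁻¹' T =
      ⋃ t ∈ {t : Set (Site 2) | t.Finite ∧ g t ∈ T}, {γ | hit D ε γ = t} := by
    ext γ
    constructor
    · intro hγ
      exact mem_biUnion (show hit D ε γ ∈ {t : Set (Site 2) | t.Finite ∧ g t ∈ T} from
        ⟨hit_finite D ε hε γ, hγ⟩) (show hit D ε γ = hit D ε γ from rfl)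
    · intro hγ
      obtain ⟨t, ht, hγt⟩ := mem_iUnion₂.1 hγ
      have ht' : t.Finite ∧ g t ∈ T := ht
      have hγt' : hit D ε γ = t := hγt
      show g (hit D ε γ) ∈ T
      rw [hγt']
      exact ht'.2
  rw [h]
  exact MeasurableSet.biUnion hcount fun t _ => measurableSet_hit_eq D ε t

/-- The box count `N_ε` is Borel measurable (`ε > 0`). [folklore] -/
theorem measurable_ncard_hit (hε : 0 < ε) : Measurable fun γ => ((hit D ε γ).ncard : ℝ) :=
  measurable_comp_hit D ε hε fun W => (W.ncard : ℝ)

/-- The regularising density is Borel measurable (`ε > 0`). [folklore] -/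
theorem measurable_dens (hε : 0 < ε) : Measurable (dens D θ ε) :=
  measurable_comp_hit D ε hε fun W =>
    Real.exp (θ ε * (W.ncard : ℝ) - rwLoopMass (discreteDomainGraph D.carrier ε) W)

/-! ### Positivity and finiteness of the normalising constant -/

/-- The density is positive. [folklore] -/
theorem dens_pos (γ : CurveClass ℂ) : 0 < dens D θ ε γ := Real.exp_pos _

/-- Uniform bound `dens_ε(γ) ≤ exp (|θ ε| · #Ω_ε)` for `ε > 0` (`N_ε ≤ #Ω_ε` and the loop mass is
nonnegative). [folklore] -/
theorem dens_le (hε : 0 < ε) (γ : CurveClass ℂ) :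
    dens D θ ε γ ≤ Real.exp (|θ ε| * ((meshDomain D.carrier ε).ncard : ℝ)) := by
  unfold dens
  refine Real.exp_le_exp.2 ?_
  have h1 : ((hit D ε γ).ncard : ℝ) ≤ ((meshDomain D.carrier ε).ncard : ℝ) := by
    exact_mod_cast ncard_hit_le D ε hε γ
  have h2 := rwLoopMass_nonneg (discreteDomainGraph D.carrier ε) (hit D ε γ)
  have h3 : θ ε * ((hit D ε γ).ncard : ℝ) ≤ |θ ε| * ((hit D ε γ).ncard : ℝ) :=
    mul_le_mul_of_nonneg_right (le_abs_self _) (Nat.cast_nonneg _)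
  have h4 : |θ ε| * ((hit D ε γ).ncard : ℝ) ≤ |θ ε| * ((meshDomain D.carrier ε).ncard : ℝ) :=
    mul_le_mul_of_nonneg_left h1 (abs_nonneg _)
  linarith

/-- The normalising constant is bounded by `exp (|θ ε| · #Ω_ε) · μ(univ)` (`ε > 0`). [folklore] -/
theorem lintegral_dens_le (hε : 0 < ε) :
    ∫⁻ γ, ENNReal.ofReal (dens D θ ε γ) ∂μ ≤
      ENNReal.ofReal (Real.exp (|θ ε| * ((meshDomain D.carrier ε).ncard : ℝ))) * μ univ := by
  calc ∫⁻ γ, ENNReal.ofReal (dens D θ ε γ) ∂μ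
      ≤ ∫⁻ _, ENNReal.ofReal (Real.exp (|θ ε| * ((meshDomain D.carrier ε).ncard : ℝ))) ∂μ :=
        lintegral_mono fun γ => ENNReal.ofReal_le_ofReal (dens_le D θ ε hε γ)
    _ = _ := lintegral_const _

/-- For a finite measure `μ` and `ε > 0` the normalising constant is finite. [folklore] -/
theorem lintegral_dens_lt_top [IsFiniteMeasure μ] (hε : 0 < ε) :
    ∫⁻ γ, ENNReal.ofReal (dens D θ ε γ) ∂μ < ∞ :=
  (lintegral_dens_le D θ μ ε hε).trans_lt
    (ENNReal.mul_lt_top ENNReal.ofReal_lt_top (measure_lt_top μ _))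

/-- For `μ ≠ 0` and `ε > 0` the normalising constant is nonzero (the density is positive).
[folklore] -/
theorem lintegral_dens_ne_zero (hε : 0 < ε) (hμ : μ ≠ 0) :
    ∫⁻ γ, ENNReal.ofReal (dens D θ ε γ) ∂μ ≠ 0 := by
  rw [Ne, lintegral_eq_zero_iff (measurable_dens D θ ε hε).ennreal_ofReal]
  intro h
  have hfalse : ∀ᵐ γ ∂μ, False := h.mono fun γ hγ => by
    have hp := dens_pos D θ ε γ
    simp only [Pi.zero_apply, ENNReal.ofReal_eq_zero] at hγ
    linarith
  exact hμ (ae_eq_bot.1 (Filter.eventually_false_iff_eq_bot.1 hfalse))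

/-! ### The regularised law: basic properties -/

/-- The regularised law of a measurable set: `reg(s) = (∫⁻ dens dμ)⁻¹ · ∫⁻_s dens dμ`. [folklore] -/
theorem regularisedLaw_apply {s : Set (CurveClass ℂ)} (hs : MeasurableSet s) :
    regularisedLaw D θ μ ε s =
      (∫⁻ γ, ENNReal.ofReal (dens D θ ε γ) ∂μ)⁻¹ * ∫⁻ γ in s, ENNReal.ofReal (dens D θ ε γ) ∂μ := by
  rw [regularisedLaw, Measure.smul_apply, withDensity_apply _ hs, smul_eq_mul]

/-- The regularised law is absolutely continuous with respect to `μ`. [folklore] -/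
theorem regularisedLaw_absolutelyContinuous : regularisedLaw D θ μ ε ≪ μ :=
  Measure.smul_absolutelyContinuous.trans (withDensity_absolutelyContinuous μ _)

/-- **The regularised law is a probability measure** for a probability measure `μ`, a Dobrushin
domain and `ε > 0` (the normalising constant is then in `(0, ∞)`). [folklore] -/
theorem isProbabilityMeasure_regularisedLaw [IsProbabilityMeasure μ] (hε : 0 < ε) :
    IsProbabilityMeasure (regularisedLaw D θ μ ε) := by
  refine ⟨?_⟩
  rw [regularisedLaw_apply D θ μ ε MeasurableSet.univ, Measure.restrict_univ,
    ENNReal.inv_mul_cancel (lintegral_dens_ne_zero D θ μ ε hε (IsProbabilityMeasure.ne_zero μ))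
      (lintegral_dens_lt_top D θ μ ε hε).ne]

/-- **Change of measure**: for `ε > 0`, `∫ f d reg_ε = (∫⁻ dens dμ)⁻¹ · ∫ dens_ε · f dμ` (Bochner
integrals, any `f`; both sides are `0` for non-integrable `dens • f`). [folklore] -/
theorem integral_regularisedLaw {E : Type*} [NormedAddCommGroup E] [NormedSpace ℝ E] (hε : 0 < ε)
    (f : CurveClass ℂ → E) :
    ∫ γ, f γ ∂(regularisedLaw D θ μ ε) =
      ((∫⁻ γ, ENNReal.ofReal (dens D θ ε γ) ∂μ)⁻¹).toReal • ∫ γ, dens D θ ε γ • f γ ∂μ := by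
  rw [regularisedLaw, integral_smul_measure,
    integral_withDensity_eq_integral_toReal_smul (measurable_dens D θ ε hε).ennreal_ofReal
      (Filter.Eventually.of_forall fun _ => ENNReal.ofReal_lt_top)]
  congr 1
  refine integral_congr_ae (Filter.Eventually.of_forall fun γ => ?_)
  simp only [ENNReal.toReal_ofReal (dens_pos D θ ε γ).le]

/-! ### Counterterm cancellation (the density ratio between two domains) -/

/-- **Counterterm cancellation.** If the hit sets of `γ` at cutoff `ε` in two Dobrushin domains
`D'` and `D` agree (e.g. `D' ⊆ D` and `γ` at distance `≥ 2ε` from `D ∖ D'`, with compatible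
discretisations), then the box-count counterterms cancel in the ratio of the densities, which is a
pure loop-measure quantity:
`dens^{D'}_ε(γ) / dens^{D}_ε(γ) = exp (m_{Ω_ε}(W) − m_{Ω'_ε}(W))`, `W = hit_ε γ` — the first half of
the mesoscopic restriction identity behind crux `ChaosRestriction` (the second half identifies the
exponent with the mass of the loops of `Ω_ε` meeting `W` that are not loops of `Ω'_ε`). [folklore] -/
theorem dens_div_dens_of_hit_eq {D D' : DobrushinDomain} {γ : CurveClass ℂ}
    (h : hit D' ε γ = hit D ε γ) :
    dens D' θ ε γ / dens D θ ε γ =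
      Real.exp (rwLoopMass (discreteDomainGraph D.carrier ε) (hit D ε γ) -
        rwLoopMass (discreteDomainGraph D'.carrier ε) (hit D ε γ)) := by
  rw [dens, dens, h, ← Real.exp_sub]
  congr 1
  ring

/-- The same cancellation in product form: `dens^{D'} = exp (m_Ω(W) − m_{Ω'}(W)) · dens^{D}`.
[folklore] -/
theorem dens_eq_exp_mul_dens_of_hit_eq {D D' : DobrushinDomain} {γ : CurveClass ℂ}
    (h : hit D' ε γ = hit D ε γ) :
    dens D' θ ε γ =
      Real.exp (rwLoopMass (discreteDomainGraph D.carrier ε) (hit D ε γ) -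
        rwLoopMass (discreteDomainGraph D'.carrier ε) (hit D ε γ)) * dens D θ ε γ := by
  rw [← dens_div_dens_of_hit_eq θ ε h, div_mul_cancel₀ _ (dens_pos D θ ε γ).ne']

end LoopAvoidance

end Literature.Probability.RandomPlanarGeometry
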